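import Literature.Algebra.Polynomial.CasasAlvero.Degree4
import HarnessLib

/-!
# The Casas-Alvero property under scaling `X ↦ s·X` and under nonzero constant multiples

`IsCasasAlvero f → IsCasasAlvero (f(sX))` for `s ≠ 0` and `IsCasasAlvero f → IsCasasAlvero (c·f)` for `c ≠ 0` (over a field), via the
identity `H_k (f(sX)) = s^k · (H_k f)(sX)`.  Together with the Taylor shift (`IsCasasAlvero.taylor`) these are the normalisations
"translate a root to 0, scale another root to 1" used by every search in this directory.  [folklore]
-/

noncomputable section

open Polynomial

namespace Literature.Algebra.Polynomial.CasasAlvero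

variable {K : Type*} [Field K]

/-- coefficients of `f(sX)`. [folklore] -/
theorem coeff_comp_C_mul_X (p : K[X]) (s : K) (n : ℕ) : (p.comp (C s * X)).coeff n = s ^ n * p.coeff n := by
  induction p using Polynomial.induction_on' with
  | add p q hp hq => simp only [add_comp, coeff_add, hp, hq, mul_add]
  | monomial k a =>
      rw [← C_mul_X_pow_eq_monomial, mul_comp, C_comp, X_pow_comp, mul_pow, ← C_pow, ← mul_assoc, ← C_mul,
        coeff_C_mul_X_pow, coeff_C_mul_X_pow]
      split_ifs with h
      · subst h; ring
      · simp

/-- `H_k (f(sX)) = s^k · (H_k f)(sX)`. [folklore] -/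
theorem hasseDeriv_comp_C_mul_X (p : K[X]) (s : K) (k : ℕ) :
    hasseDeriv k (p.comp (C s * X)) = C (s ^ k) * (hasseDeriv k p).comp (C s * X) := by
  ext n
  rw [hasseDeriv_coeff, coeff_comp_C_mul_X, coeff_C_mul, coeff_comp_C_mul_X, hasseDeriv_coeff]
  ring

/-- degree of `f(sX)` for `s ≠ 0`. [folklore] -/
theorem natDegree_comp_C_mul_X (p : K[X]) {s : K} (hs : s ≠ 0) : (p.comp (C s * X)).natDegree = p.natDegree := by
  rw [natDegree_comp, natDegree_C_mul_X s hs, mul_one]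

/-- a shared root `θ` of `f, g` gives the shared root `θ/s` of `f(sX)`, `c · g(sX)`. [folklore] -/
theorem SharesRoot.comp_C_mul_X {f g : K[X]} {s : K} (hs : s ≠ 0) (c : K) (h : SharesRoot f g) :
    SharesRoot (f.comp (C s * X)) (C c * g.comp (C s * X)) := by
  obtain ⟨θ, hf, hg⟩ := h
  refine ⟨θ / s, ?_, ?_⟩
  · rw [eval_comp, eval_mul, eval_C, eval_X, mul_div_cancel₀ _ hs, hf]
  · rw [eval_mul, eval_C, eval_comp, eval_mul, eval_C, eval_X, mul_div_cancel₀ _ hs, hg, mul_zero]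

/-- **Scaling invariance**: `f` Casas-Alvero ⇒ `f(sX)` Casas-Alvero (`s ≠ 0`). [folklore] -/
theorem IsCasasAlvero.comp_C_mul_X {f : K[X]} {s : K} (hs : s ≠ 0) (h : IsCasasAlvero f) :
    IsCasasAlvero (f.comp (C s * X)) := by
  intro i hi0 hi
  rw [natDegree_comp_C_mul_X f hs] at hi
  rw [hasseDeriv_comp_C_mul_X]
  exact (h i hi0 hi).comp_C_mul_X hs _

/-- `H_k (c · f) = c · H_k f`. [folklore] -/
theorem hasseDeriv_C_mul (c : K) (f : K[X]) (k : ℕ) : hasseDeriv k (C c * f) = C c * hasseDeriv k f := by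
  rw [← smul_eq_C_mul, ← smul_eq_C_mul, LinearMap.map_smul]

/-- **Constant multiples**: `f` Casas-Alvero ⇒ `c · f` Casas-Alvero (`c ≠ 0`). [folklore] -/
theorem IsCasasAlvero.C_mul {f : K[X]} {c : K} (hc : c ≠ 0) (h : IsCasasAlvero f) : IsCasasAlvero (C c * f) := by
  intro i hi0 hi
  rw [natDegree_C_mul hc] at hi
  rw [hasseDeriv_C_mul]
  obtain ⟨θ, hf, hg⟩ := h i hi0 hi
  exact ⟨θ, by rw [eval_mul, eval_C, hf, mul_zero], by rw [eval_mul, eval_C, hg, mul_zero]⟩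

/-- the monic rescaling `s^{-d} · f(sX)` of a monic `f` of degree `d` is monic of degree `d` and Casas-Alvero when `f` is (`s ≠ 0`):
the normalisation moving a nonzero root `s` of `f` to `1`. [folklore] -/
theorem IsCasasAlvero.rescale {f : K[X]} {s : K} (hs : s ≠ 0) (hf : f.Monic) (h : IsCasasAlvero f) :
    (C (s ^ f.natDegree)⁻¹ * f.comp (C s * X)).Monic ∧
      (C (s ^ f.natDegree)⁻¹ * f.comp (C s * X)).natDegree = f.natDegree ∧
        IsCasasAlvero (C (s ^ f.natDegree)⁻¹ * f.comp (C s * X)) := by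
  have hsd : s ^ f.natDegree ≠ 0 := pow_ne_zero _ hs
  have hlc : (f.comp (C s * X)).leadingCoeff = s ^ f.natDegree := by
    rw [leadingCoeff, natDegree_comp_C_mul_X f hs, coeff_comp_C_mul_X, ← leadingCoeff, hf.leadingCoeff, mul_one]
  refine ⟨?_, ?_, (h.comp_C_mul_X hs).C_mul (inv_ne_zero hsd)⟩
  · rw [Monic, leadingCoeff_mul, leadingCoeff_C, hlc, inv_mul_cancel₀ hsd]
  · rw [natDegree_C_mul (inv_ne_zero hsd), natDegree_comp_C_mul_X f hs]

end Literature.Algebra.Polynomial.CasasAlvero
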